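import Mathlib.GroupTheory.Commutator.Basic
import Literature.AnabelianGeometry.AbsoluteAnabelian.FreeProSigmaCompletionBridge
import Literature.GroupTheory.CocycleCentralExtension
import HarnessLib

/-!
# The cusp of a once-punctured torus, profinitely: `⟨[a, b]⟩⁻` in a free profinite group is free procyclic and injects into the Heisenberg quotient

Group theory behind the (g, r) = (1, 1) instance of [AbsTopIII] Prop. 1.4 (Mochizuki, *Topics in Absolute
Anabelian Geometry III*, §1, Prop. 1.4 (i)/(ii), manuscript p. 31, lit key `paper:url-5493eb38cbb7`): for a
once-punctured torus `U_x = X ∖ {x}` one has `Δ_{U_x} = F̂₂ = ⟨a, b⟩^` free profinite ([AbsTopI] Lem. 4.5 (i)),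
the inertia group of the cusp is `I_x = ⟨[a, b]⟩⁻ ≅ Ẑ` (Prop. 1.4 (i)), `Δ_X = F̂₂ / ⟨⟨[a, b]⟩⟩⁻ ≅ Ẑ²`, and
the maximal cuspidally central quotient `Δ^{c-cn}_{U_x} = F̂₂ / [⟨⟨[a,b]⟩⟩⁻, F̂₂]⁻` is the profinite
Heisenberg group, into which `I_x` INJECTS (Prop. 1.4 (ii): `1 → I_x → Δ^{c-cn}_{U_x} → Δ_X → 1` exact).
This proof-only file (no definitions, no named facts) proves these group-theoretic statements for ANY
profinite group `P` free pro-`Σ` (`Σ ⊇ {primes}`) on generators `gens` in the sense of abc-iut-L4-t4's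
`IsFreeProOn` and any two distinct generators `a = gens i`, `b = gens j`:

* (private) `exists_finite_group_commutator_central` — for every `m ≥ 1` a finite group with two elements
  whose commutator is CENTRAL of order exactly `m` (the Heisenberg group `H(ℤ/m)`, built as the tree's
  `Literature.GroupTheory.TwistedProduct` of `(ℤ/m)²` by `ℤ/m` along the bilinear cocycle `x y'`), and the
  images of closures under continuous homomorphisms to discrete groups;
* `IsFreeProOn.isFreeProcyclic_topologicalClosure_zpowers_commutator` — **`⟨[a, b]⟩⁻` is free procyclic**
  (`FundamentalExtension.IsFreeProcyclic`: dense cyclic subgroup; an open subgroup of each index `m`, the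
  kernel of `⟨[a,b]⟩⁻ → H(ℤ/m)`);
* `topologicalClosure_zpowers_commutator_le` — `⟨[a, b]⟩⁻ ≤ [P, P]⁻` (one puncture);
* `IsFreeProOn.topologicalClosure_zpowers_commutator_inf_eq_bot` — **`⟨[a, b]⟩⁻ ∩ [N, P]⁻ = 1`** for
  `N = ⟨⟨[a, b]⟩⟩⁻` the closed normal subgroup generated by `⟨[a, b]⟩⁻` — the injectivity clause of the
  cuspidally central extension — by the joint continuous maps `P → P/U × H(ℤ/m)`.

Consumer: the once-punctured-torus MODEL of the `CurveModel` interface (`AbsTopIII/…`), a genuine cyclotome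
presentation at which the instance-class theorems for F-0338 / F-0365 fire non-vacuously.
HONEST FRAMING: classical (pro)finite group theory; nothing here bears on [IUTchIII] Cor. 3.12; typed ≠ proved
elsewhere.
-/

noncomputable section

open Topology

namespace Literature.AnabelianGeometry.AbsoluteAnabelian

open Literature.GroupTheory

universe u

/-! ### Finite Heisenberg groups: a central commutator of any prescribed order -/

/-- **For every `m ≥ 1` there is a finite group with two elements whose commutator is CENTRAL of order
exactly `m`** — the Heisenberg group `H(ℤ/m)` (upper unitriangular `3 × 3` matrices over `ℤ/m`),
realised as the tree's twisted product `(ℤ/m)² ×_c ℤ/m` for the bilinear cocycle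
`c((x,y),(x',y')) = x y'`, with `x = (1,0)`, `y = (0,1)`, `[x, y] = (0, 0; 1)`. [folklore] -/
private theorem exists_finite_group_commutator_central (m : ℕ) (hm : 0 < m) :
    ∃ (K : Type) (_ : Group K) (_ : Finite K) (x y : K),
      x * y * x⁻¹ * y⁻¹ ∈ Subgroup.center K ∧ orderOf (x * y * x⁻¹ * y⁻¹) = m := by
  haveI : NeZero m := ⟨hm.ne'⟩
  let c : CentralCocycle (Multiplicative (ZMod m × ZMod m)) (Multiplicative (ZMod m)) :=
    { toFun := fun g h =>
        Multiplicative.ofAdd ((Multiplicative.toAdd g).1 * (Multiplicative.toAdd h).2)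
      cocycle' := fun g h l => by
        rw [← ofAdd_add, ← ofAdd_add, toAdd_mul, toAdd_mul, Prod.fst_add, Prod.snd_add]
        congr 1
        ring
      map_one_one' := by
        rw [toAdd_one, Prod.fst_zero, zero_mul, ofAdd_zero] }
  let x : TwistedProduct c := ⟨Multiplicative.ofAdd (1, 0), 1⟩
  let y : TwistedProduct c := ⟨Multiplicative.ofAdd (0, 1), 1⟩
  have hxy' : x * y = TwistedProduct.inl c (Multiplicative.ofAdd 1) * (y * x) := by
    refine TwistedProduct.ext ?_ ?_
    · change Multiplicative.ofAdd ((1 : ZMod m), (0 : ZMod m)) * Multiplicative.ofAdd (0, 1) =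
        1 * (Multiplicative.ofAdd (0, 1) * Multiplicative.ofAdd (1, 0))
      rw [one_mul, mul_comm]
    · change (1 : Multiplicative (ZMod m)) * 1 * Multiplicative.ofAdd ((1 : ZMod m) * 1) =
        Multiplicative.ofAdd (1 : ZMod m) * (1 * 1 * Multiplicative.ofAdd ((0 : ZMod m) * 0)) *
          c 1 (Multiplicative.ofAdd (0, 1) * Multiplicative.ofAdd (1, 0))
      rw [CentralCocycle.map_one_left, mul_one, mul_zero, ofAdd_zero, mul_one, one_mul, one_mul,
        mul_one, mul_one]
  have hxy : x * y * x⁻¹ * y⁻¹ = TwistedProduct.inl c (Multiplicative.ofAdd 1) := by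
    simp only [hxy', mul_assoc, mul_inv_cancel, mul_one]
  refine ⟨TwistedProduct c, inferInstance, ?_, x, y, ?_, ?_⟩
  · exact Finite.of_equiv (Multiplicative (ZMod m × ZMod m) × Multiplicative (ZMod m))
      ⟨fun p => ⟨p.1, p.2⟩, fun z => (z.g, z.a), fun _ => rfl, fun _ => rfl⟩
  · rw [hxy]
    exact TwistedProduct.inl_mem_center _
  · rw [hxy, orderOf_injective (TwistedProduct.inl c) TwistedProduct.inl_injective,
      orderOf_ofAdd_eq_addOrderOf, ZMod.addOrderOf_one]

/-! ### Continuous homomorphisms to finite (discrete) groups: images of closures -/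

section Discrete

variable {P : Type u} [Group P] [TopologicalSpace P] [IsTopologicalGroup P]
  {K : Type*} [Group K] [TopologicalSpace K] [DiscreteTopology K]

/-- Under a continuous homomorphism to a DISCRETE group, the closure `H⁻` of a subgroup has the same
image as `H` (`ψ(H⁻) ⊆ (ψ H)⁻ = ψ H`). [folklore] -/
private theorem Subgroup.map_topologicalClosure_eq_of_discreteTopology (ψ : P →* K) (hψ : Continuous ψ)
    (H : Subgroup P) : H.topologicalClosure.map ψ = H.map ψ := by
  refine le_antisymm ?_ (Subgroup.map_mono (Subgroup.le_topologicalClosure H))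
  rintro _ ⟨g, hg, rfl⟩
  have h1 : ψ g ∈ closure (ψ '' (H : Set P)) :=
    image_closure_subset_closure_image hψ ⟨g, hg, rfl⟩
  rw [(isClosed_discrete _).closure_eq] at h1
  obtain ⟨x, hx, hxg⟩ := h1
  exact Subgroup.mem_map.mpr ⟨x, hx, hxg⟩

/-- In particular the closure of a cyclic subgroup `⟨c⟩⁻` maps into `⟨ψ c⟩`. [folklore] -/
private theorem map_mem_zpowers_of_mem_topologicalClosure_zpowers (ψ : P →* K) (hψ : Continuous ψ) (c : P)
    {g : P} (hg : g ∈ (Subgroup.zpowers c).topologicalClosure) : ψ g ∈ Subgroup.zpowers (ψ c) := by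
  rw [← MonoidHom.map_zpowers, ← Subgroup.map_topologicalClosure_eq_of_discreteTopology ψ hψ]
  exact Subgroup.mem_map_of_mem ψ hg

end Discrete

/-! ### The commutator of two free generators of a free profinite group -/

section Cusp

variable {P : Type u} [Group P] [TopologicalSpace P] [IsTopologicalGroup P]
  [CompactSpace P] [TotallyDisconnectedSpace P]
  {S : Set ℕ} {n : ℕ} {gens : Fin n → P}

omit [IsTopologicalGroup P] [CompactSpace P] [TotallyDisconnectedSpace P] in
/-- The universal property at a PAIR of generators: a continuous homomorphism to a finite discrete group
with prescribed values on `gens i`, `gens j` (`i ≠ j`; the other generators go to `1`), for `Σ ⊇ {primes}`.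
[cite: MochizukiAbsTopI2012, Lemma 4.5 (i) p.54] -/
theorem IsFreeProOn.exists_continuous_hom_pair (hS : ∀ p : ℕ, p.Prime → p ∈ S)
    (hP : IsFreeProOn P S gens) {i j : Fin n} (hij : i ≠ j) (K : Type) [Group K] [Finite K]
    [TopologicalSpace K] [DiscreteTopology K] (x y : K) :
    ∃ ψ : P →* K, Continuous ψ ∧ ψ (gens i) = x ∧ ψ (gens j) = y := by
  classical
  obtain ⟨ψ, ⟨hψc, hψ⟩, -⟩ := hP.2 K (fun q hq _ => hS q hq)
    (fun k => if k = i then x else if k = j then y else 1)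
  refine ⟨ψ, hψc, ?_, ?_⟩
  · rw [hψ i, if_pos rfl]
  · rw [hψ j, if_neg hij.symm, if_pos rfl]

omit [CompactSpace P] [TotallyDisconnectedSpace P] in
/-- **The closed subgroup `⟨[a, b]⟩⁻` topologically generated by the commutator of two distinct free
generators of a free pro-`Σ` group (`Σ ⊇ {primes}`) is FREE PROCYCLIC** (`≅ Ẑ`: a dense cyclic subgroup,
and an open subgroup of every index `m ≥ 1` — the kernel of the continuous map to the Heisenberg group
`H(ℤ/m)`, under which `[a, b]` goes to a central element of order `m`).  This is the inertia group of the
cusp of a once-punctured torus (`π₁ = F₂ = ⟨a, b⟩`, puncture class `[a, b]`), profinitely.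
[cite: MochizukiAbsTopI2012, Lemma 4.5 (i) p.54] -/
theorem IsFreeProOn.isFreeProcyclic_topologicalClosure_zpowers_commutator
    (hS : ∀ p : ℕ, p.Prime → p ∈ S) (hP : IsFreeProOn P S gens) {i j : Fin n} (hij : i ≠ j) :
    FundamentalExtension.IsFreeProcyclic
      (Subgroup.zpowers (gens i * gens j * (gens i)⁻¹ * (gens j)⁻¹)).topologicalClosure := by
  classical
  set c := gens i * gens j * (gens i)⁻¹ * (gens j)⁻¹ with hc
  have hcI : c ∈ (Subgroup.zpowers c).topologicalClosure :=
    Subgroup.le_topologicalClosure _ (Subgroup.mem_zpowers c)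
  refine ⟨⟨⟨c, hcI⟩, ?_⟩, fun m hm => ?_⟩
  · -- `⟨c⟩` is dense in `⟨c⟩⁻`
    rw [Topology.IsInducing.subtypeVal.dense_iff]
    rintro ⟨g, hg⟩
    refine closure_mono ?_ hg
    rintro p hp
    obtain ⟨k, rfl⟩ := Subgroup.mem_zpowers_iff.mp hp
    exact ⟨⟨c, hcI⟩ ^ k, ⟨k, rfl⟩, Subgroup.coe_zpow _ _ _⟩
  · -- an open subgroup of index `m`: the kernel of `⟨c⟩⁻ → H(ℤ/m)`
    obtain ⟨K, _, _, x, y, hz, hord⟩ := exists_finite_group_commutator_central m hm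
    letI : TopologicalSpace K := ⊥
    haveI : DiscreteTopology K := ⟨rfl⟩
    obtain ⟨ψ, hψc, hψi, hψj⟩ := hP.exists_continuous_hom_pair hS hij K x y
    have hψc' : ψ c = x * y * x⁻¹ * y⁻¹ := by simp only [hc, map_mul, map_inv, hψi, hψj]
    let φ : (Subgroup.zpowers c).topologicalClosure →* K :=
      ψ.comp (Subgroup.zpowers c).topologicalClosure.subtype
    have hφc : Continuous φ := hψc.comp continuous_subtype_val
    have hrange : φ.range = Subgroup.zpowers (x * y * x⁻¹ * y⁻¹) := by
      apply le_antisymm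
      · rintro _ ⟨g, rfl⟩
        rw [← hψc']
        exact map_mem_zpowers_of_mem_topologicalClosure_zpowers ψ hψc c g.2
      · rw [Subgroup.zpowers_le, ← hψc']
        exact ⟨⟨c, hcI⟩, rfl⟩
    refine ⟨φ.ker, ?_, ?_⟩
    · rw [MonoidHom.coe_ker]
      exact (isOpen_discrete _).preimage hφc
    · rw [Subgroup.index_ker, hrange, Nat.card_zpowers, hord]

omit [TopologicalSpace P] [IsTopologicalGroup P] [CompactSpace P] [TotallyDisconnectedSpace P] in
/-- A commutator lies in the commutator subgroup `[P, P]`. [folklore] -/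
private theorem commutator_mem_commutator_top (a b : P) :
    a * b * a⁻¹ * b⁻¹ ∈ ⁅(⊤ : Subgroup P), (⊤ : Subgroup P)⁆ := by
  have h := Subgroup.commutator_mem_commutator (Subgroup.mem_top a) (Subgroup.mem_top b)
    (H₁ := (⊤ : Subgroup P)) (H₂ := (⊤ : Subgroup P))
  rwa [commutatorElement_def] at h

omit [CompactSpace P] [TotallyDisconnectedSpace P] in
/-- `⟨[a, b]⟩⁻ ≤ [P, P]⁻` (one puncture: the cusp's inertia dies in the abelianisation).
[cite: MochizukiAbsTopIII2015, Prop 1.4 (ii) p.31] -/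
theorem topologicalClosure_zpowers_commutator_le (a b : P) :
    (Subgroup.zpowers (a * b * a⁻¹ * b⁻¹)).topologicalClosure ≤
      (⁅(⊤ : Subgroup P), (⊤ : Subgroup P)⁆).topologicalClosure := by
  apply Subgroup.topologicalClosure_mono
  rw [Subgroup.zpowers_le]
  exact commutator_mem_commutator_top a b

/-- **`⟨[a, b]⟩⁻ ∩ [N, P]⁻ = 1`** for `N := ⟨⟨[a, b]⟩⟩⁻` the closed normal subgroup generated by the
commutator of two distinct free generators of a free pro-`Σ` group `P` (`Σ ⊇ {primes}`): the cusp's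
inertia INJECTS into the maximal cuspidally central quotient `P/[N, P]⁻` (the profinite Heisenberg
quotient).  Proof: an element `g` of the intersection lies in every open normal `U`: with `m` the order
of `[a, b]` mod `U` and `ψ : P → H(ℤ/m)` (`a ↦ x`, `b ↦ y`, `[x, y] = z` central of order `m`), the joint
continuous map `P → P/U × H(ℤ/m)` sends `⟨[a,b]⟩⁻` into `⟨([a,b] mod U, z)⟩`, so
`(g mod U, ψ g) = ([a,b]^k mod U, z^k)`; but `ψ` kills `[N, P]⁻` (`ψ(N)` is central), so `z^k = 1`,
`m ∣ k`, and `g ≡ [a,b]^k ≡ 1 mod U`. [cite: MochizukiAbsTopIII2015, Prop 1.4 (ii) p.31] -/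
theorem IsFreeProOn.topologicalClosure_zpowers_commutator_inf_eq_bot
    (hS : ∀ p : ℕ, p.Prime → p ∈ S) (hP : IsFreeProOn P S gens) {i j : Fin n} (hij : i ≠ j) :
    (Subgroup.zpowers (gens i * gens j * (gens i)⁻¹ * (gens j)⁻¹)).topologicalClosure ⊓
      (⁅(Subgroup.normalClosure
          ((Subgroup.zpowers (gens i * gens j * (gens i)⁻¹ * (gens j)⁻¹)).topologicalClosure :
            Set P)).topologicalClosure, (⊤ : Subgroup P)⁆).topologicalClosure = ⊥ := by
  classical
  set c := gens i * gens j * (gens i)⁻¹ * (gens j)⁻¹ with hc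
  set I := (Subgroup.zpowers c).topologicalClosure with hI
  set N := (Subgroup.normalClosure (I : Set P)).topologicalClosure with hN
  rw [eq_bot_iff]
  rintro g ⟨hgI, hgJ⟩
  rw [Subgroup.mem_bot]
  by_contra hg1
  -- an open normal subgroup missing `g`
  obtain ⟨U, hU⟩ := ProfiniteGrp.exist_openNormalSubgroup_sub_open_nhds_of_one
    (isOpen_compl_singleton (x := g)) (show (1 : P) ∈ ({g}ᶜ : Set P) from fun h => hg1 h.symm)
  apply hU _ rfl
  show g ∈ (U : Subgroup P)
  -- the finite quotient `P ⧸ U` and the order `m` of `c` there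
  haveI : Finite (P ⧸ (U : Subgroup P)) := Subgroup.quotient_finite_of_isOpen _ U.isOpen'
  haveI : DiscreteTopology (P ⧸ (U : Subgroup P)) := QuotientGroup.discreteTopology U.isOpen'
  obtain ⟨K, _, _, x, y, hz, hord⟩ := exists_finite_group_commutator_central
    (orderOf (QuotientGroup.mk c : P ⧸ (U : Subgroup P))) (orderOf_pos _)
  letI : TopologicalSpace K := ⊥
  haveI : DiscreteTopology K := ⟨rfl⟩
  obtain ⟨ψ, hψc, hψi, hψj⟩ := hP.exists_continuous_hom_pair hS hij K x y
  have hψc' : ψ c = x * y * x⁻¹ * y⁻¹ := by simp only [hc, map_mul, map_inv, hψi, hψj]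
  -- the joint map `P → P/U × K`
  let Ψ : P →* (P ⧸ (U : Subgroup P)) × K := (QuotientGroup.mk' (U : Subgroup P)).prod ψ
  have hΨc : Continuous Ψ := QuotientGroup.continuous_mk.prodMk hψc
  obtain ⟨k, hk⟩ := Subgroup.mem_zpowers_iff.mp
    (map_mem_zpowers_of_mem_topologicalClosure_zpowers Ψ hΨc c hgI)
  have hk1 : (QuotientGroup.mk c : P ⧸ (U : Subgroup P)) ^ k = QuotientGroup.mk g :=
    congrArg Prod.fst hk
  have hk2 : (x * y * x⁻¹ * y⁻¹) ^ k = ψ g := by rw [← hψc']; exact congrArg Prod.snd hk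
  -- `ψ` kills `[N, P]⁻`: `ψ(N)` is central
  have hψI : I.map ψ ≤ Subgroup.center K := by
    rw [hI, Subgroup.map_topologicalClosure_eq_of_discreteTopology ψ hψc, MonoidHom.map_zpowers,
      Subgroup.zpowers_le, hψc']
    exact hz
  have hψN : N.map ψ ≤ Subgroup.center K := by
    rw [hN, Subgroup.map_topologicalClosure_eq_of_discreteTopology ψ hψc, Subgroup.map_le_iff_le_comap]
    exact Subgroup.normalClosure_le_normal (Subgroup.map_le_iff_le_comap.mp hψI)
  have hψJ : (⁅N, (⊤ : Subgroup P)⁆).topologicalClosure.map ψ = ⊥ := by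
    rw [Subgroup.map_topologicalClosure_eq_of_discreteTopology ψ hψc, Subgroup.map_commutator,
      eq_bot_iff]
    have h0 : ⁅Subgroup.center K, (⊤ : Subgroup K)⁆ = ⊥ := by
      rw [Subgroup.commutator_eq_bot_iff_le_centralizer]
      intro k hk
      rw [Subgroup.mem_centralizer_iff]
      intro l _
      exact Subgroup.mem_center_iff.mp hk l
    rw [← h0]
    exact Subgroup.commutator_mono hψN le_top
  have hψg : ψ g = 1 := by
    rw [← Subgroup.mem_bot, ← hψJ]
    exact Subgroup.mem_map_of_mem ψ hgJ
  -- so `z ^ k = 1`, `m ∣ k`, `c ^ k ∈ U`, `g ∈ U`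
  rw [hψg, ← orderOf_dvd_iff_zpow_eq_one, hord, orderOf_dvd_iff_zpow_eq_one, hk1] at hk2
  exact (QuotientGroup.eq_one_iff g).mp hk2

end Cusp

end Literature.AnabelianGeometry.AbsoluteAnabelian
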